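import Summits.CriticalPhenomena.PercolationContinuityZ3.Theorems.PercNearOneGluingNoHeavyLowerTailNineTypeTwins

/-!
# Nine-type programme for `Q44b`: the basis + co-representative ASSEMBLY lemma (K3 ⟹ count)

Support file for crux `stmt-CriticalPhenomena-4575` (master-family programme, quadratic four-point row `Q44b`,
GF(2)-rank line of `prim-bnk-1` gen 16–19), seat `prim-bnk-1` gen 19; memo
`run/shared/lean/prim/prim-l12/FROM-prim-bnk-1-gen19-HALL-GRAM-ASSEMBLY.md`.

The residual conjecture of the programme (K3, memo gen 18 §2) has the shape: the H-rows of a "basis" `E \ D` of the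
bad points are GF(2)-independent over the goods `Z`, and the L-rows (co-representatives `ρ d`, `d ∈ D`) of the
"defect" points are independent MODULO the span of all H-rows.  This file proves, once and for all and in the
counting ("odd target") language of `…NineTypeAnchor`, that these two hypotheses give `#E ≤ #Z`:

* `NineType.card_le_card_of_coreps` — if every nonempty subfamily of `E \ D` has an odd target in `Z`, and for
  every nonempty `R ⊆ D` and every `𝒮 ⊆ E \ D` some `T ∈ Z` makes `#{S ∈ 𝒮 : S ⊆ T} + #{d ∈ R : ρ d ⊆ T}` odd
  (the co-representatives `ρ d ∉ E` being distinct), then `#E ≤ #Z`.  Proof: the family `(E \ D) ∪ ρ(D)` has `#E`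
  members and every nonempty subfamily has an odd target, so `card_le_card_of_odd_targets` applies.
* `NineType.card_le_card_of_pivot` — the one-defect case `D = {c}`, `ρ c = cᶜ`, phrased with the hypotheses
  "every nonempty subfamily of `E` without odd target contains `c`" (the H-rows have corank ≤ 1 and `c` lies on the
  circuit) and "no `𝒮 ⊆ E` represents the L-row of `c`" (the conclusion of the circuit lemmas `…NineTypeTwins`,
  `…NineTypeRectangle(All)`, `…NineTypeForks`, `…NineTypeJoin`).
* `NineType.twins_corank_one_card_le` — COROLLARY: a CONT+COV configuration with a twin pair `t ~ a`
  (`t` free, `a` of type 8/9) in which every H-dependency passes through `t` satisfies `#𝒯 ≤ #𝔊` — the first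
  counting theorem of the programme for a configuration containing the `{5,7} × {8,9}` clash.

Pure finite combinatorics; no named facts, no sorries, standard axioms.
-/

namespace Summit.CriticalPhenomena.PercolationContinuityZ3.Theorems

namespace NineType

open Finset

variable {α : Type*} [DecidableEq α]

/-- Counting a filter over a disjoint union. -/
theorem card_filter_union_of_disjoint (A B : Finset (Finset α)) (hAB : Disjoint A B) (p : Finset α → Prop)
    [DecidablePred p] : #((A ∪ B).filter p) = #(A.filter p) + #(B.filter p) := by
  rw [Finset.filter_union]
  exact Finset.card_union_of_disjoint (Finset.disjoint_filter_filter hAB)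

/-- Counting a filter over an injective image. -/
theorem card_filter_image_of_injOn (D : Finset (Finset α)) (ρ : Finset α → Finset α) (hinj : Set.InjOn ρ D)
    (p : Finset α → Prop) [DecidablePred p] :
    #((D.image ρ).filter p) = #(D.filter (fun d => p (ρ d))) := by
  rw [Finset.filter_image, Finset.card_image_of_injOn]
  intro x hx y hy hxy
  exact hinj (Finset.mem_filter.1 (Finset.mem_coe.1 hx)).1 (Finset.mem_filter.1 (Finset.mem_coe.1 hy)).1 hxy

/-- **Assembly lemma (basis + co-representatives ⟹ count).**  Let `D ⊆ E`, and let `ρ` assign to each `d ∈ D` a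
"co-representative" `ρ d ∉ E`, injectively on `D`.  If every nonempty subfamily of `E \ D` has an odd target in `Z`,
and for every nonempty `R ⊆ D` and every `𝒮 ⊆ E \ D` some `T ∈ Z` makes `#{S ∈ 𝒮 : S ⊆ T} + #{d ∈ R : ρ d ⊆ T}` odd,
then `#E ≤ #Z`.  (With H-rows of `E \ D` and L-rows `ρ d = dᶜ` this is "K3 ⟹ `#𝒯 ≤ #𝔊`", memo gen 18 §2.)
[this work] -/
theorem card_le_card_of_coreps (E Z D : Finset (Finset α)) (hD : D ⊆ E)
    (ρ : Finset α → Finset α) (hρE : ∀ d ∈ D, ρ d ∉ E) (hρinj : Set.InjOn ρ D)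
    (hB : ∀ 𝒮 ⊆ E \ D, 𝒮.Nonempty → ∃ T ∈ Z, Odd #(𝒮.filter (fun S => S ⊆ T)))
    (hW : ∀ R ⊆ D, R.Nonempty → ∀ 𝒮 ⊆ E \ D,
      ∃ T ∈ Z, Odd (#(𝒮.filter (fun S => S ⊆ T)) + #(R.filter (fun d => ρ d ⊆ T)))) :
    #E ≤ #Z := by
  classical
  -- the assembled family
  set F : Finset (Finset α) := (E \ D) ∪ D.image ρ with hF
  have hdisj : Disjoint (E \ D) (D.image ρ) := by
    rw [Finset.disjoint_left]
    intro x hx hx'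
    rcases Finset.mem_image.1 hx' with ⟨d, hd, rfl⟩
    exact hρE d hd (Finset.mem_sdiff.1 hx).1
  have hcardF : #F = #E := by
    rw [hF, Finset.card_union_of_disjoint hdisj, Finset.card_image_of_injOn hρinj,
      Finset.card_sdiff_of_subset hD, Nat.sub_add_cancel (Finset.card_le_card hD)]
  rw [← hcardF]
  apply card_le_card_of_odd_targets F Z
  intro 𝒮 h𝒮 hne
  -- split 𝒮 into its E-part and its ρ-part
  set 𝒮₀ : Finset (Finset α) := 𝒮.filter (fun S => S ∈ E \ D) with h𝒮₀
  set R : Finset (Finset α) := D.filter (fun d => ρ d ∈ 𝒮) with hR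
  have h𝒮₀E : 𝒮₀ ⊆ E \ D := fun S hS => (Finset.mem_filter.1 hS).2
  have hRD : R ⊆ D := Finset.filter_subset _ _
  have hsplit : 𝒮 = 𝒮₀ ∪ R.image ρ := by
    ext S
    constructor
    · intro hS
      have hSF := h𝒮 hS
      rw [hF, Finset.mem_union] at hSF
      rcases hSF with h1 | h2
      · exact Finset.mem_union.2 (Or.inl (Finset.mem_filter.2 ⟨hS, h1⟩))
      · rcases Finset.mem_image.1 h2 with ⟨d, hd, rfl⟩
        exact Finset.mem_union.2 (Or.inr (Finset.mem_image.2 ⟨d, Finset.mem_filter.2 ⟨hd, hS⟩, rfl⟩))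
    · intro hS
      rcases Finset.mem_union.1 hS with h1 | h2
      · exact (Finset.mem_filter.1 h1).1
      · rcases Finset.mem_image.1 h2 with ⟨d, hd, rfl⟩
        exact (Finset.mem_filter.1 hd).2
  have hdisj0 : Disjoint 𝒮₀ (R.image ρ) := by
    rw [Finset.disjoint_left]
    intro x hx hx'
    rcases Finset.mem_image.1 hx' with ⟨d, hd, rfl⟩
    exact hρE d (hRD hd) (Finset.mem_sdiff.1 (h𝒮₀E hx)).1
  have hinjR : Set.InjOn ρ R := fun x hx y hy hxy => hρinj (hRD hx) (hRD hy) hxy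
  have hcount : ∀ T : Finset α,
      #(𝒮.filter (fun S => S ⊆ T)) = #(𝒮₀.filter (fun S => S ⊆ T)) + #(R.filter (fun d => ρ d ⊆ T)) := by
    intro T
    rw [hsplit, card_filter_union_of_disjoint _ _ hdisj0, card_filter_image_of_injOn _ _ hinjR]
  by_cases hR0 : R = ∅
  · -- no co-representatives involved: 𝒮 = 𝒮₀ ⊆ E \ D
    have h𝒮eq : 𝒮 = 𝒮₀ := by rw [hsplit, hR0, Finset.image_empty, Finset.union_empty]
    have hne0 : 𝒮₀.Nonempty := h𝒮eq ▸ hne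
    obtain ⟨T, hT, hoddT⟩ := hB 𝒮₀ h𝒮₀E hne0
    exact ⟨T, hT, h𝒮eq ▸ hoddT⟩
  · obtain ⟨T, hT, hoddT⟩ := hW R hRD (Finset.nonempty_iff_ne_empty.2 hR0) 𝒮₀ h𝒮₀E
    exact ⟨T, hT, (hcount T).symm ▸ hoddT⟩

/-- From a failed ZMod-2 parity representation to an odd count (bookkeeping). -/
theorem odd_add_of_parity_ne (n : ℕ) (b : Prop) [Decidable b]
    (h : ((n : ℕ) : ZMod 2) ≠ if b then 1 else 0) : Odd (n + if b then 1 else 0) := by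
  by_cases hb : b
  · rw [if_pos hb] at h
    rw [if_pos hb]
    have hev : Even n := by
      rcases Nat.even_or_odd n with he | ho
      · exact he
      · exfalso
        apply h
        rcases ho with ⟨k, hk⟩
        rw [hk]; push_cast
        rw [show (2 : ZMod 2) = 0 from rfl]; ring
    exact hev.add_one
  · rw [if_neg hb] at h
    rw [if_neg hb, add_zero]
    rcases Nat.even_or_odd n with he | ho
    · exfalso
      exact h ((ZMod.natCast_eq_zero_iff_even).2 he)
    · exact ho

/-- **One-defect assembly (pivot form).**  Let `c ∈ E` with `cᶜ ∉ E`.  If every nonempty subfamily of `E` WITHOUT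
an odd target in `Z` contains `c` (the H-rows have corank ≤ 1 and `c` lies on the circuit), and no `𝒮 ⊆ E`
represents the L-row of `c` (`#{S ∈ 𝒮 : S ⊆ T} ≡ [cᶜ ⊆ T]` for all `T ∈ Z` is impossible), then `#E ≤ #Z`.
[this work] -/
theorem card_le_card_of_pivot [Fintype α] (E Z : Finset (Finset α)) (c : Finset α) (hc : c ∈ E) (hcc : cᶜ ∉ E)
    (hdep : ∀ 𝒮 ⊆ E, 𝒮.Nonempty → (∀ T ∈ Z, ¬ Odd #(𝒮.filter (fun S => S ⊆ T))) → c ∈ 𝒮)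
    (hL : ∀ 𝒮 ⊆ E, ¬ (∀ T ∈ Z, ((#(𝒮.filter (fun S => S ⊆ T)) : ℕ) : ZMod 2) = if cᶜ ⊆ T then 1 else 0)) :
    #E ≤ #Z := by
  classical
  refine card_le_card_of_coreps E Z {c} (Finset.singleton_subset_iff.2 hc) (fun d => dᶜ) ?_ ?_ ?_ ?_
  · intro d hd
    rw [Finset.mem_singleton] at hd
    rw [hd]; exact hcc
  · intro x _ y _ hxy
    exact compl_injective hxy
  · intro 𝒮 h𝒮 hne
    by_contra hno
    have hno' : ∀ T ∈ Z, ¬ Odd #(𝒮.filter (fun S => S ⊆ T)) := fun T hT hodd => hno ⟨T, hT, hodd⟩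
    have hcS : c ∈ 𝒮 := hdep 𝒮 (fun S hS => (Finset.mem_sdiff.1 (h𝒮 hS)).1) hne hno'
    exact (Finset.mem_sdiff.1 (h𝒮 hcS)).2 (Finset.mem_singleton_self c)
  · intro R hR hRne 𝒮 h𝒮
    have hReq : R = {c} := by
      apply Finset.Subset.antisymm hR
      intro x hx
      rw [Finset.mem_singleton] at hx
      obtain ⟨y, hy⟩ := hRne
      have hy' : y = c := Finset.mem_singleton.1 (hR hy)
      rw [hx, ← hy']; exact hy
    have h𝒮E : 𝒮 ⊆ E := fun S hS => (Finset.mem_sdiff.1 (h𝒮 hS)).1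
    have hL' : ∃ T ∈ Z, ((#(𝒮.filter (fun S => S ⊆ T)) : ℕ) : ZMod 2) ≠ if cᶜ ⊆ T then 1 else 0 := by
      by_contra hno
      apply hL 𝒮 h𝒮E
      intro T hT
      by_contra hneq
      exact hno ⟨T, hT, hneq⟩
    obtain ⟨T, hT, hneq⟩ := hL'
    refine ⟨T, hT, ?_⟩
    rw [hReq, Finset.filter_singleton]
    by_cases hcT : cᶜ ⊆ T
    · rw [if_pos hcT, Finset.card_singleton]
      have := odd_add_of_parity_ne _ _ hneq
      rw [if_pos hcT] at this
      exact this
    · rw [if_neg hcT, Finset.card_empty]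
      have := odd_add_of_parity_ne _ _ hneq
      rw [if_neg hcT] at this
      exact this

/-- **Corollary (twin circuit through a free point, corank one ⟹ count).**  In a CONT+COV configuration with
goods `𝔊` (up-set containing the HL- and HH-forced unions), let `t` (type 5/7) and `a` (type 8/9) be twins
(`t ⊆ g ↔ a ⊆ g` for all goods).  If every nonempty subfamily of `𝒯` without an odd target in `𝔊` contains `t`
(e.g. the twin pair is the only H-circuit), then `#𝒯 ≤ #𝔊`.  [this work; uses `twins_L_row_not_H_combination`] -/
theorem twins_corank_one_card_le [Fintype α] (𝒯 : Finset (Finset α)) (θ : Finset α → ℕ)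
    (hθ : ∀ s ∈ 𝒯, 1 ≤ θ s ∧ θ s ≤ 9)
    (hcont : ∀ s ∈ 𝒯, ∀ s' ∈ 𝒯, s ⊆ s' → (θ s, θ s') ∈ contPairs)
    (hcov : ∀ s ∈ 𝒯, ∀ s' ∈ 𝒯, s ≠ s' → s ∪ s' ≠ univ)
    (𝔊 : Finset (Finset α)) (hG : ∀ g ∈ 𝔊, ∀ g' : Finset α, g ⊆ g' → g' ∈ 𝔊)
    (hHL : ∀ s ∈ 𝒯, ∀ s' ∈ 𝒯, hlOK (θ s) (θ s') = true → s ∪ s'ᶜ ∈ 𝔊)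
    (hHH : ∀ s ∈ 𝒯, ∀ s' ∈ 𝒯, s ≠ s' → hhOK (θ s) (θ s') = true → s ∪ s' ∈ 𝔊)
    (t : Finset α) (ht : t ∈ 𝒯) (ht57 : θ t = 5 ∨ θ t = 7)
    (a : Finset α) (ha : a ∈ 𝒯) (ha89 : θ a = 8 ∨ θ a = 9)
    (htwin : ∀ g ∈ 𝔊, t ⊆ g ↔ a ⊆ g)
    (hdep : ∀ 𝒮 ⊆ 𝒯, 𝒮.Nonempty → (∀ g ∈ 𝔊, ¬ Odd #(𝒮.filter (fun S => S ⊆ g))) → t ∈ 𝒮) :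
    #𝒯 ≤ #𝔊 := by
  classical
  have htc : tᶜ ∉ 𝒯 := by
    intro htc
    by_cases heq : tᶜ = t
    · -- then `univ = t ∪ tᶜ = t`, and `t ∪ a = univ` contradicts COV unless `t = a`, which the types forbid
      have hta : t ≠ a := by
        intro h
        rcases ht57 with h5 | h7 <;> rcases ha89 with h8 | h9 <;> rw [h] at * <;> omega
      apply hcov t ht a ha hta
      apply Finset.eq_univ_of_forall
      intro x
      by_cases hx : x ∈ t
      · exact Finset.mem_union.2 (Or.inl hx)
      · have : x ∈ tᶜ := Finset.mem_compl.2 hx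
        rw [heq] at this
        exact absurd this hx
    · exact hcov t ht tᶜ htc (Ne.symm heq) (Finset.union_compl t)
  exact card_le_card_of_pivot 𝒯 𝔊 t ht htc hdep
    (fun 𝒮 h𝒮 => twins_L_row_not_H_combination 𝒯 θ hθ hcont hcov 𝔊 hG hHL hHH t ht ht57 a ha ha89 htwin 𝒮 h𝒮)

end NineType

end Summit.CriticalPhenomena.PercolationContinuityZ3.Theorems
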